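import Summits.ValiantsHypothesis.ValiantsHypothesis.Theorems.SymPencilPerFourHessianMinors
import Summits.ValiantsHypothesis.ValiantsHypothesis.Theorems.SymPencilPerFourPairingDiscTools

/-!
# Route `SymPencil` — inner rank of the `2 | 2` row split of `per_4`: line-polynomial functions of
# the row `a` (`--supports` stmt-ValiantsHypothesis-5674 `SdcSuperquadratic`; (8,8) column,
# isotropic-kernel route, helpers for `SymPencilPerFourInnerRankSlotA`)

`a ↦ t_r((a,0),v)` (linear), `a ↦ t_r((a,0), φ a)` for additive homogeneous `φ` (quadratic) and
`a ↦ ∏ a_i` are polynomial along lines, and the factor `∏ a_i` can be cancelled from an identity in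
`a` (via `SymPencilPerFourHessianMinors.forall_eq_zero_or_of_mul₃`).  Honest framing: glue in a
conditional reduction of the cells `(8,8,10)`, `(8,8,11)`; nothing about the window, the crux or
`VP ≠ VNP`.  No definitions, no named facts. [folklore]
-/

noncomputable section

-- single-conjunct layout: Sub = Summit, duplicated namespace component intended
set_option linter.dupNamespace false

namespace Summit.ValiantsHypothesis.ValiantsHypothesis.Theorems.SymPencilPerFourInnerRankSlotALinePoly

open Finset Polynomial
open Summit.ValiantsHypothesis.ValiantsHypothesis.Theorems.SymPencilPerFourPairingDiscTools
open Summit.ValiantsHypothesis.ValiantsHypothesis.Theorems.SymPencilPerFourHessianMinors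

variable {K : Type*} [Field K] {ι : Type*}

/-! ### Line-polynomial functions of the row `a` -/

/-- `a ↦ t_r((a,0), v)` is polynomial along lines (it is linear). [folklore] -/
theorem linePoly_slot
    (t : ι → (((Fin 4 → K) × (Fin 4 → K)) →ₗ[K] ((Fin 4 → K) × (Fin 4 → K)) →ₗ[K] K))
    (r : ι) (v : (Fin 4 → K) × (Fin 4 → K)) :
    ∀ y₀ y : Fin 4 → K, ∃ p : K[X], ∀ s : K,
      (fun a : Fin 4 → K => t r (a, 0) v) (y₀ + s • y) = p.eval s := by
  intro y₀ y
  refine ⟨C (t r (y₀, 0) v) + C (t r (y, 0) v) * X, fun s => ?_⟩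
  have h : ((y₀ + s • y, (0 : Fin 4 → K)) : (Fin 4 → K) × (Fin 4 → K)) = (y₀, 0) + s • (y, 0) := by
    simp
  simp only [h, map_add, map_smul, LinearMap.add_apply, LinearMap.smul_apply, smul_eq_mul,
    eval_add, eval_mul, eval_C, eval_X]
  ring

/-- `a ↦ t_r((a,0), φ a)` is polynomial along lines for an additive and homogeneous `φ`
(it is quadratic). [folklore] -/
theorem linePoly_slot_quad
    (t : ι → (((Fin 4 → K) × (Fin 4 → K)) →ₗ[K] ((Fin 4 → K) × (Fin 4 → K)) →ₗ[K] K))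
    (r : ι) (φ : (Fin 4 → K) → (Fin 4 → K) × (Fin 4 → K))
    (hadd : ∀ x y, φ (x + y) = φ x + φ y) (hsmul : ∀ (s : K) x, φ (s • x) = s • φ x) :
    ∀ y₀ y : Fin 4 → K, ∃ p : K[X], ∀ s : K,
      (fun a : Fin 4 → K => t r (a, 0) (φ a)) (y₀ + s • y) = p.eval s := by
  intro y₀ y
  refine ⟨C (t r (y₀, 0) (φ y₀)) + C (t r (y₀, 0) (φ y) + t r (y, 0) (φ y₀)) * X +
    C (t r (y, 0) (φ y)) * X ^ 2, fun s => ?_⟩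
  have h : ((y₀ + s • y, (0 : Fin 4 → K)) : (Fin 4 → K) × (Fin 4 → K)) = (y₀, 0) + s • (y, 0) := by
    simp
  simp only [h, hadd, hsmul, map_add, map_smul, LinearMap.add_apply, LinearMap.smul_apply,
    smul_eq_mul, eval_add, eval_mul, eval_C, eval_X, eval_pow]
  ring

/-- `a ↦ ∏ a_i` is polynomial along lines. [folklore] -/
theorem linePoly_coordProd :
    ∀ y₀ y : Fin 4 → K, ∃ p : K[X], ∀ s : K,
      (fun a : Fin 4 → K => ∏ i, a i) (y₀ + s • y) = p.eval s :=
  linePoly_prod (Finset.univ : Finset (Fin 4)) (f := fun (i : Fin 4) (a : Fin 4 → K) => a i)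
    (fun i _ => linePoly_linear (LinearMap.proj i : (Fin 4 → K) →ₗ[K] K))

/-- Cancelling the factor `∏ a_i` from an identity in `a`. [folklore] -/
theorem cancel_coordProd [Infinite K] {g : (Fin 4 → K) → K}
    (hg : ∀ y₀ y : Fin 4 → K, ∃ p : K[X], ∀ s : K, g (y₀ + s • y) = p.eval s)
    (h : ∀ a : Fin 4 → K, g a * ∏ i, a i = 0) : ∀ a, g a = 0 := by
  have H : ∀ a ∈ (⊤ : Submodule K (Fin 4 → K)),
      g a * (fun a : Fin 4 → K => ∏ i, a i) a * (fun _ : Fin 4 → K => (1 : K)) a = 0 := by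
    intro a _; simp only [mul_one]; exact h a
  rcases forall_eq_zero_or_of_mul₃ ⊤ hg linePoly_coordProd (fun y₀ y => linePoly_const 1 y₀ y) H
    with h1 | h1 | h1
  · exact fun a => h1 a Submodule.mem_top
  · exfalso
    have := h1 (fun _ => (1 : K)) Submodule.mem_top
    simp at this
  · exfalso
    have := h1 0 Submodule.mem_top
    simp at this

end Summit.ValiantsHypothesis.ValiantsHypothesis.Theorems.SymPencilPerFourInnerRankSlotALinePoly

end
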